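import Summits.AnomalousDissipation.AnomalousDissipation.Theorems.MarginalStabilityChainStrainedLayerLawStubVorticityUniformBoundsC
import Summits.AnomalousDissipation.AnomalousDissipation.Theorems.MarginalStabilityChainStrainedLayerLawStubExcessEnergyKinematicB

/-!
# Stub `stub_vorticityUniformBounds` (crux stmt-AnomalousDissipation-3007, line `strain-work-sum-rule`) — tools D:
# the weak vorticity balance of the stretched layer system

Support file (`--supports stmt-AnomalousDissipation-3007`; registered sub-goal
`stub_vorticityUniformBounds_weakVorticity`). For a classical solution of the stretched two-dimensional
Navier–Stokes layer system the velocity is `C²` and the pressure `C¹`, so the vorticity `ω = ∂ₓv − ∂_yu` is only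
`C¹`: `∂ₜω` exists but `Δω` and the pointwise vorticity equation do not. This file proves the vorticity equation
`∂ₜω + div(ω(u, v − y)) = νΔω` in WEAK-IN-SPACE form at one instant: with slice data `u, v ∈ C²`, `p ∈ C¹` and
time-derivative slices `a = ∂ₜu`, `b = ∂ₜv ∈ C¹` satisfying the momentum equations and `∂ₓu + ∂_yv = 0`
(`u, v, p, b` `L`-periodic in `x`), for every `C¹` test function `Φ`, `L`-periodic in `x` and vanishing for
`|y| ≥ R`,

  `∫∫_{(0,L]×ℝ} Φ (∂ₓb − ∂_ya) = ∫∫ ω (u∂ₓΦ + (v − y)∂_yΦ) − ν ∫∫ (∂ₓω ∂ₓΦ + ∂_yω ∂_yΦ)`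

(`stub_vorticityUniformBounds_weakVorticity`; in tools F the left-hand side is identified with `∫∫ Φ ∂ₜω` by the
symmetry of second derivatives in space–time). Ingredients: integration by parts on the period strip
(`StretchedLayerStripCalculus`), the transport defect `∂ₓΦ·α + ∂_yΦ·β` with `∂ₓα + ∂_yβ = 0` (mixed partials of
`u, v` commute), the pressure lemma of tools C, and the pointwise identities `∂ₓω = Δv`, `∂_yω = −Δu`
(`kato_dX_vorticity`, `kato_dY_vorticity`). All `[folklore]` (Majda–Bertozzi 2002, §1.4 and §3.1.1 for the
system; the weak form is the standard one).
-/

-- `Summit.<Summit>.<Problem>` is the tree's mandated summit-side namespace (CONVENTIONS §2); for this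
-- single-conjunct summit the two coincide, so the duplicate is deliberate.
set_option linter.dupNamespace false

noncomputable section

open scoped Topology ENNReal
open Filter Set Function MeasureTheory

namespace Summit.AnomalousDissipation.AnomalousDissipation.Theorems.StrainedLayerLaw.StrainWorkSumRule

open Literature.Analysis.FluidPDE Literature.Analysis.FluidPDE.StretchedLayer
open Summit.AnomalousDissipation.AnomalousDissipation.Theorems.MarginalStabilityChainStretchedVortexRows

/-! ## The weak vorticity balance -/

section WeakVorticity

/-- **The weak vorticity balance of the stretched layer system (registered sub-goal
`stub_vorticityUniformBounds_weakVorticity`).** Slice data at one instant: `u, v ∈ C²(ℝ²)`, `p ∈ C¹(ℝ²)` and the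
time-derivative slices `a = ∂ₜu`, `b = ∂ₜv ∈ C¹(ℝ²)` satisfying the momentum equations
`a + u∂ₓu + (v − y)∂_yu = −∂ₓp + νΔu`, `b + u∂ₓv + (v − y)∂_yv − v = −∂_yp + νΔv`, `∂ₓu + ∂_yv = 0`, with
`u, v, p, b` `L`-periodic in `x` (`L > 0`). Then for every test function `Φ ∈ C¹(ℝ²)`, `L`-periodic in `x` and
vanishing for `|y| ≥ R`, the vorticity `ω = ∂ₓv − ∂_yu` satisfies
`∫∫_{(0,L]×ℝ} Φ (∂ₓb − ∂_ya) = ∫∫ ω (u∂ₓΦ + (v − y)∂_yΦ) − ν ∫∫ (∂ₓω ∂ₓΦ + ∂_yω ∂_yΦ)`,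
i.e. `∂ₜω + div(ω(u, v − y)) = νΔω` tested against `Φ` (integration by parts; the transport defect
`∂ₓΦ·α + ∂_yΦ·β`, `α = −v + (v−y)∂_yv + u∂_yu`, `β = −u∂ₓu − (v−y)∂ₓv`, integrates to zero because
`∂ₓα + ∂_yβ = 0`; the pressure drops out by `stub_vorticityUniformBounds_pressureWeak`; `Δv = ∂ₓω`,
`Δu = −∂_yω`). [folklore] -/
theorem stub_vorticityUniformBounds_weakVorticity : ∀ (L ν R : ℝ) (u v p a b Φ : ℝ → ℝ → ℝ), 0 < L →
    ContDiff ℝ 2 (fun q : ℝ × ℝ => u q.1 q.2) → ContDiff ℝ 2 (fun q : ℝ × ℝ => v q.1 q.2) →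
    ContDiff ℝ 1 (fun q : ℝ × ℝ => p q.1 q.2) → ContDiff ℝ 1 (fun q : ℝ × ℝ => a q.1 q.2) →
    ContDiff ℝ 1 (fun q : ℝ × ℝ => b q.1 q.2) → ContDiff ℝ 1 (fun q : ℝ × ℝ => Φ q.1 q.2) →
    (∀ x y, a x y + u x y * dX u x y + (v x y - y) * dY u x y = -dX p x y + ν * lap u x y) →
    (∀ x y, b x y + u x y * dX v x y + (v x y - y) * dY v x y - v x y = -dY p x y + ν * lap v x y) →
    (∀ x y, dX u x y + dY v x y = 0) →
    (∀ x y, u (x + L) y = u x y) → (∀ x y, v (x + L) y = v x y) → (∀ x y, p (x + L) y = p x y) →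
    (∀ x y, b (x + L) y = b x y) → (∀ x y, Φ (x + L) y = Φ x y) → (∀ x y, R ≤ |y| → Φ x y = 0) →
      ∫ q in Ioc 0 L ×ˢ univ, Φ q.1 q.2 * (dX b q.1 q.2 - dY a q.1 q.2) =
        (∫ q in Ioc 0 L ×ˢ univ, vorticity u v q.1 q.2 *
            (u q.1 q.2 * dX Φ q.1 q.2 + (v q.1 q.2 - q.2) * dY Φ q.1 q.2)) -
          ν * ∫ q in Ioc 0 L ×ˢ univ,
            (dX (vorticity u v) q.1 q.2 * dX Φ q.1 q.2 + dY (vorticity u v) q.1 q.2 * dY Φ q.1 q.2) := by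
  intro L ν R u v p a b Φ hL hu hv hp ha hb hΦ hmx hmy hdiv huper hvper hpper hbper hΦper hΦ0
  -- continuity facts
  have hu1 : ContDiff ℝ 1 (fun q : ℝ × ℝ => u q.1 q.2) := hu.of_le one_le_two
  have hv1 : ContDiff ℝ 1 (fun q : ℝ × ℝ => v q.1 q.2) := hv.of_le one_le_two
  have cu : Continuous fun q : ℝ × ℝ => u q.1 q.2 := hu.continuous
  have cv : Continuous fun q : ℝ × ℝ => v q.1 q.2 := hv.continuous
  have cp : Continuous fun q : ℝ × ℝ => p q.1 q.2 := hp.continuous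
  have ca : Continuous fun q : ℝ × ℝ => a q.1 q.2 := ha.continuous
  have cb : Continuous fun q : ℝ × ℝ => b q.1 q.2 := hb.continuous
  have cΦ : Continuous fun q : ℝ × ℝ => Φ q.1 q.2 := hΦ.continuous
  have cux : Continuous fun q : ℝ × ℝ => dX u q.1 q.2 := continuous_dX hu1
  have cuy : Continuous fun q : ℝ × ℝ => dY u q.1 q.2 := continuous_dY hu1
  have cvx : Continuous fun q : ℝ × ℝ => dX v q.1 q.2 := continuous_dX hv1
  have cvy : Continuous fun q : ℝ × ℝ => dY v q.1 q.2 := continuous_dY hv1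
  have cpx : Continuous fun q : ℝ × ℝ => dX p q.1 q.2 := continuous_dX hp
  have cpy : Continuous fun q : ℝ × ℝ => dY p q.1 q.2 := continuous_dY hp
  have cay : Continuous fun q : ℝ × ℝ => dY a q.1 q.2 := continuous_dY ha
  have cbx : Continuous fun q : ℝ × ℝ => dX b q.1 q.2 := continuous_dX hb
  have cΦx : Continuous fun q : ℝ × ℝ => dX Φ q.1 q.2 := continuous_dX hΦ
  have cΦy : Continuous fun q : ℝ × ℝ => dY Φ q.1 q.2 := continuous_dY hΦ
  have cuxy : Continuous fun q : ℝ × ℝ => dX (dY u) q.1 q.2 := continuous_dX (contDiff_one_dY hu)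
  have cuyx : Continuous fun q : ℝ × ℝ => dY (dX u) q.1 q.2 := continuous_dY (contDiff_one_dX hu)
  have cvxy : Continuous fun q : ℝ × ℝ => dX (dY v) q.1 q.2 := continuous_dX (contDiff_one_dY hv)
  have cvyx : Continuous fun q : ℝ × ℝ => dY (dX v) q.1 q.2 := continuous_dY (contDiff_one_dX hv)
  have clu : Continuous fun q : ℝ × ℝ => lap u q.1 q.2 := (continuous_dXdX hu).add (continuous_dYdY hu)
  have clv : Continuous fun q : ℝ × ℝ => lap v q.1 q.2 := (continuous_dXdX hv).add (continuous_dYdY hv)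
  have hω1 : ContDiff ℝ 1 (fun q : ℝ × ℝ => vorticity u v q.1 q.2) := contDiff_one_vorticity hu hv
  have cω : Continuous fun q : ℝ × ℝ => vorticity u v q.1 q.2 := hω1.continuous
  have cωx : Continuous fun q : ℝ × ℝ => dX (vorticity u v) q.1 q.2 := continuous_dX hω1
  have cωy : Continuous fun q : ℝ × ℝ => dY (vorticity u v) q.1 q.2 := continuous_dY hω1
  -- support facts
  have hΦ0' : ∀ x y, R + 1 ≤ |y| → Φ x y = 0 := fun x y hy => hΦ0 x y (by linarith)
  have hΦX0 : ∀ x y, R + 1 ≤ |y| → dX Φ x y = 0 := fun x y hy => kato_dX_eq_zero hΦ0 (by linarith)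
  have hΦY0 : ∀ x y, R + 1 ≤ |y| → dY Φ x y = 0 := fun x y hy => kato_dY_eq_zero hΦ0 hy
  -- integrability of everything carrying a factor `Φ`, `∂ₓΦ` or `∂_yΦ` on the left
  have hIΦ : ∀ G : ℝ × ℝ → ℝ, Continuous G →
      IntegrableOn (fun q : ℝ × ℝ => Φ q.1 q.2 * G q) (Ioc 0 L ×ˢ univ) := fun G hG =>
    kato_integrableOn_strip_of_eq_zero (cΦ.mul hG) fun x _ y hy => by rw [hΦ0' x y hy, zero_mul]
  have hIX : ∀ G : ℝ × ℝ → ℝ, Continuous G →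
      IntegrableOn (fun q : ℝ × ℝ => dX Φ q.1 q.2 * G q) (Ioc 0 L ×ˢ univ) := fun G hG =>
    kato_integrableOn_strip_of_eq_zero (cΦx.mul hG) fun x _ y hy => by rw [hΦX0 x y hy, zero_mul]
  have hIY : ∀ G : ℝ × ℝ → ℝ, Continuous G →
      IntegrableOn (fun q : ℝ × ℝ => dY Φ q.1 q.2 * G q) (Ioc 0 L ×ˢ univ) := fun G hG =>
    kato_integrableOn_strip_of_eq_zero (cΦy.mul hG) fun x _ y hy => by rw [hΦY0 x y hy, zero_mul]
  -- slice derivatives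
  have hux : ∀ x y, HasDerivAt (fun s => u s y) (dX u x y) x := hasDerivAt_dX_of_contDiff hu two_ne_zero
  have huy : ∀ x y, HasDerivAt (fun s => u x s) (dY u x y) y := hasDerivAt_dY_of_contDiff hu two_ne_zero
  have hvx : ∀ x y, HasDerivAt (fun s => v s y) (dX v x y) x := hasDerivAt_dX_of_contDiff hv two_ne_zero
  have hvy : ∀ x y, HasDerivAt (fun s => v x s) (dY v x y) y := hasDerivAt_dY_of_contDiff hv two_ne_zero
  have hΦx : ∀ x y, HasDerivAt (fun s => Φ s y) (dX Φ x y) x := hasDerivAt_dX_of_contDiff hΦ one_ne_zero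
  have hΦy : ∀ x y, HasDerivAt (fun s => Φ x s) (dY Φ x y) y := hasDerivAt_dY_of_contDiff hΦ one_ne_zero
  have hbx : ∀ x y, HasDerivAt (fun s => b s y) (dX b x y) x := hasDerivAt_dX_of_contDiff hb one_ne_zero
  have hay : ∀ x y, HasDerivAt (fun s => a x s) (dY a x y) y := hasDerivAt_dY_of_contDiff ha one_ne_zero
  have huyx : ∀ x y, HasDerivAt (fun s => dY u s y) (dX (dY u) x y) x :=
    hasDerivAt_dX_of_contDiff (contDiff_one_dY hu) one_ne_zero
  have hvyx : ∀ x y, HasDerivAt (fun s => dY v s y) (dX (dY v) x y) x :=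
    hasDerivAt_dX_of_contDiff (contDiff_one_dY hv) one_ne_zero
  have huxy : ∀ x y, HasDerivAt (fun s => dX u x s) (dY (dX u) x y) y :=
    hasDerivAt_dY_of_contDiff (contDiff_one_dX hu) one_ne_zero
  have hvxy : ∀ x y, HasDerivAt (fun s => dX v x s) (dY (dX v) x y) y :=
    hasDerivAt_dY_of_contDiff (contDiff_one_dX hv) one_ne_zero
  -- Step 1: split the left-hand side
  have e1 : ∫ q in Ioc 0 L ×ˢ univ, Φ q.1 q.2 * (dX b q.1 q.2 - dY a q.1 q.2) =
      (∫ q in Ioc 0 L ×ˢ univ, Φ q.1 q.2 * dX b q.1 q.2) - ∫ q in Ioc 0 L ×ˢ univ, Φ q.1 q.2 * dY a q.1 q.2 := by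
    rw [← integral_sub (hIΦ _ cbx) (hIΦ _ cay)]
    refine integral_congr_ae (Eventually.of_forall fun q => ?_)
    simp only; ring
  -- Step 2: integrate by parts
  have e2x : ∫ q in Ioc 0 L ×ˢ univ, Φ q.1 q.2 * dX b q.1 q.2 = -∫ q in Ioc 0 L ×ˢ univ, dX Φ q.1 q.2 * b q.1 q.2 := by
    refine integral_strip_mul_dX_eq_neg hL.le hΦx hbx (fun y => by fun_prop) (fun y => by fun_prop)
      (fun y => ?_) (hIΦ _ cbx) (hIX _ cb)
    have h1 := hΦper 0 y; have h2 := hbper 0 y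
    rw [zero_add] at h1 h2
    rw [h1, h2]
  have e2y : ∫ q in Ioc 0 L ×ˢ univ, Φ q.1 q.2 * dY a q.1 q.2 = -∫ q in Ioc 0 L ×ˢ univ, dY Φ q.1 q.2 * a q.1 q.2 :=
    integral_strip_mul_dY_eq_neg hΦy hay (hIΦ _ cay) (hIY _ ca) (hIΦ _ ca)
  -- Step 3: insert the momentum equations and split into transport, pressure and viscous parts
  have hb_eq : ∀ x y, b x y = v x y - u x y * dX v x y - (v x y - y) * dY v x y - dY p x y + ν * lap v x y :=
    fun x y => by linarith [hmy x y]
  have ha_eq : ∀ x y, a x y = -(u x y * dX u x y) - (v x y - y) * dY u x y - dX p x y + ν * lap u x y :=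
    fun x y => by linarith [hmx x y]
  -- the three integrands
  set T : ℝ × ℝ → ℝ := fun q => -(dX Φ q.1 q.2 * (v q.1 q.2 - u q.1 q.2 * dX v q.1 q.2 -
      (v q.1 q.2 - q.2) * dY v q.1 q.2)) + dY Φ q.1 q.2 * (-(u q.1 q.2 * dX u q.1 q.2) -
      (v q.1 q.2 - q.2) * dY u q.1 q.2) with hT
  set P : ℝ × ℝ → ℝ := fun q => dX Φ q.1 q.2 * dY p q.1 q.2 - dY Φ q.1 q.2 * dX p q.1 q.2 with hP
  set V : ℝ × ℝ → ℝ := fun q => -(dX Φ q.1 q.2 * lap v q.1 q.2) + dY Φ q.1 q.2 * lap u q.1 q.2 with hV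
  have hTI : IntegrableOn T (Ioc 0 L ×ˢ univ) := by
    have h1 := (hIX _ (show Continuous fun q : ℝ × ℝ => v q.1 q.2 - u q.1 q.2 * dX v q.1 q.2 -
      (v q.1 q.2 - q.2) * dY v q.1 q.2 by fun_prop)).neg
    have h2 := hIY _ (show Continuous fun q : ℝ × ℝ => -(u q.1 q.2 * dX u q.1 q.2) -
      (v q.1 q.2 - q.2) * dY u q.1 q.2 by fun_prop)
    exact h1.add h2
  have hPI : IntegrableOn P (Ioc 0 L ×ˢ univ) := (hIX _ cpy).sub (hIY _ cpx)
  have hVI : IntegrableOn V (Ioc 0 L ×ˢ univ) := (hIX _ clv).neg.add (hIY _ clu)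
  have e3 : (-∫ q in Ioc 0 L ×ˢ univ, dX Φ q.1 q.2 * b q.1 q.2) - -∫ q in Ioc 0 L ×ˢ univ, dY Φ q.1 q.2 * a q.1 q.2 =
      (∫ q in Ioc 0 L ×ˢ univ, T q) + (∫ q in Ioc 0 L ×ˢ univ, P q) + ν * ∫ q in Ioc 0 L ×ˢ univ, V q := by
    have hTP : IntegrableOn (fun q => T q + P q) (Ioc 0 L ×ˢ univ) := hTI.add hPI
    have hVν : IntegrableOn (fun q => ν * V q) (Ioc 0 L ×ˢ univ) := hVI.const_mul ν
    have hXb : IntegrableOn (fun q : ℝ × ℝ => -(dX Φ q.1 q.2 * b q.1 q.2)) (Ioc 0 L ×ˢ univ) := (hIX _ cb).neg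
    rw [← integral_const_mul, ← integral_add hTI hPI, ← integral_add hTP hVν, sub_neg_eq_add,
      ← integral_neg, ← integral_add hXb (hIY _ ca)]
    refine integral_congr_ae (Eventually.of_forall fun q => ?_)
    simp only [hT, hP, hV]
    rw [hb_eq q.1 q.2, ha_eq q.1 q.2]
    ring
  -- Step 4: the pressure part vanishes
  have e4 : ∫ q in Ioc 0 L ×ˢ univ, P q = 0 := by
    simp only [hP]
    rw [integral_sub (hIX _ cpy) (hIY _ cpx),
      stub_vorticityUniformBounds_pressureWeak L R p Φ hL hp hΦ hpper hΦper hΦ0, sub_self]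
  -- Step 5: the viscous part
  have e5 : ∫ q in Ioc 0 L ×ˢ univ, V q = -∫ q in Ioc 0 L ×ˢ univ,
      (dX (vorticity u v) q.1 q.2 * dX Φ q.1 q.2 + dY (vorticity u v) q.1 q.2 * dY Φ q.1 q.2) := by
    rw [← integral_neg]
    refine integral_congr_ae (Eventually.of_forall fun q => ?_)
    simp only [hV]
    rw [← lap_eq_dX_vorticity hu hv hdiv q.1 q.2,
      show dY (vorticity u v) q.1 q.2 = -lap u q.1 q.2 by rw [lap_eq_neg_dY_vorticity hu hv hdiv q.1 q.2, neg_neg]]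
    ring
  -- Step 6: the transport part
  set α : ℝ → ℝ → ℝ := fun x y => -v x y + (v x y - y) * dY v x y + u x y * dY u x y with hα
  set β : ℝ → ℝ → ℝ := fun x y => -(u x y * dX u x y) - (v x y - y) * dX v x y with hβ
  set αx : ℝ → ℝ → ℝ := fun x y => -dX v x y + (dX v x y * dY v x y + (v x y - y) * dX (dY v) x y) +
      (dX u x y * dY u x y + u x y * dX (dY u) x y) with hαx
  set βy : ℝ → ℝ → ℝ := fun x y => -(dY u x y * dX u x y + u x y * dY (dX u) x y) -
      ((dY v x y - 1) * dX v x y + (v x y - y) * dY (dX v) x y) with hβy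
  have cα : Continuous fun q : ℝ × ℝ => α q.1 q.2 := by simp only [hα]; fun_prop
  have cβ : Continuous fun q : ℝ × ℝ => β q.1 q.2 := by simp only [hβ]; fun_prop
  have cαx : Continuous fun q : ℝ × ℝ => αx q.1 q.2 := by simp only [hαx]; fun_prop
  have cβy : Continuous fun q : ℝ × ℝ => βy q.1 q.2 := by simp only [hβy]; fun_prop
  have hαd : ∀ x y, HasDerivAt (fun s => α s y) (αx x y) x := fun x y => by
    simp only [hα, hαx]
    exact ((hvx x y).neg.add (((hvx x y).sub_const y).mul (hvyx x y))).add ((hux x y).mul (huyx x y))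
  have hβd : ∀ x y, HasDerivAt (fun s => β x s) (βy x y) y := fun x y => by
    simp only [hβ, hβy]
    have h1 : HasDerivAt (fun s => v x s - s) (dY v x y - 1) y := (hvy x y).sub (hasDerivAt_id y)
    exact ((huy x y).mul (huxy x y)).neg.sub (h1.mul (hvxy x y))
  have hsum : ∀ x y, αx x y + βy x y = 0 := fun x y => by
    simp only [hαx, hβy]
    rw [PressureTools.dX_dY_comm hu x y, PressureTools.dX_dY_comm hv x y]
    ring
  have e6a : ∫ q in Ioc 0 L ×ˢ univ, T q = (∫ q in Ioc 0 L ×ˢ univ, vorticity u v q.1 q.2 *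
      (u q.1 q.2 * dX Φ q.1 q.2 + (v q.1 q.2 - q.2) * dY Φ q.1 q.2)) +
      ((∫ q in Ioc 0 L ×ˢ univ, dX Φ q.1 q.2 * α q.1 q.2) + ∫ q in Ioc 0 L ×ˢ univ, dY Φ q.1 q.2 * β q.1 q.2) := by
    have hI0 : IntegrableOn (fun q : ℝ × ℝ => vorticity u v q.1 q.2 *
        (u q.1 q.2 * dX Φ q.1 q.2 + (v q.1 q.2 - q.2) * dY Φ q.1 q.2)) (Ioc 0 L ×ˢ univ) := by
      have h1 := hIX _ (show Continuous fun q : ℝ × ℝ => vorticity u v q.1 q.2 * u q.1 q.2 by fun_prop)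
      have h2 := hIY _ (show Continuous fun q : ℝ × ℝ => vorticity u v q.1 q.2 * (v q.1 q.2 - q.2) by fun_prop)
      have h12 : IntegrableOn (fun q : ℝ × ℝ => dX Φ q.1 q.2 * (vorticity u v q.1 q.2 * u q.1 q.2) +
          dY Φ q.1 q.2 * (vorticity u v q.1 q.2 * (v q.1 q.2 - q.2))) (Ioc 0 L ×ˢ univ) := h1.add h2
      refine h12.congr_fun (fun q _ => ?_) (measurableSet_Ioc.prod MeasurableSet.univ)
      simp only
      ring
    have hαβ : IntegrableOn (fun q : ℝ × ℝ => dX Φ q.1 q.2 * α q.1 q.2 + dY Φ q.1 q.2 * β q.1 q.2)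
        (Ioc 0 L ×ˢ univ) := (hIX _ cα).add (hIY _ cβ)
    rw [← integral_add (hIX _ cα) (hIY _ cβ), ← integral_add hI0 hαβ]
    refine integral_congr_ae (Eventually.of_forall fun q => ?_)
    simp only [hT, hα, hβ, vorticity]
    ring
  have e6b : (∫ q in Ioc 0 L ×ˢ univ, dX Φ q.1 q.2 * α q.1 q.2) + ∫ q in Ioc 0 L ×ˢ univ, dY Φ q.1 q.2 * β q.1 q.2 = 0 := by
    have ibx : ∫ q in Ioc 0 L ×ˢ univ, Φ q.1 q.2 * αx q.1 q.2 = -∫ q in Ioc 0 L ×ˢ univ, dX Φ q.1 q.2 * α q.1 q.2 := by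
      refine integral_strip_mul_dX_eq_neg hL.le hΦx hαd (fun y => by fun_prop) (fun y => by fun_prop)
        (fun y => ?_) (hIΦ _ cαx) (hIX _ cα)
      have h1 := hΦper 0 y; have h2 := hvper 0 y; have h3 := huper 0 y
      have h4 := dY_periodic hvper 0 y; have h5 := dY_periodic huper 0 y
      rw [zero_add] at h1 h2 h3 h4 h5
      simp only [hα]
      rw [h1, h2, h3, h4, h5]
    have iby : ∫ q in Ioc 0 L ×ˢ univ, Φ q.1 q.2 * βy q.1 q.2 = -∫ q in Ioc 0 L ×ˢ univ, dY Φ q.1 q.2 * β q.1 q.2 :=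
      integral_strip_mul_dY_eq_neg hΦy hβd (hIΦ _ cβy) (hIY _ cβ) (hIΦ _ cβ)
    have h0 : (∫ q in Ioc 0 L ×ˢ univ, Φ q.1 q.2 * αx q.1 q.2) + ∫ q in Ioc 0 L ×ˢ univ, Φ q.1 q.2 * βy q.1 q.2 = 0 := by
      rw [← integral_add (hIΦ _ cαx) (hIΦ _ cβy)]
      refine integral_eq_zero_of_ae (Eventually.of_forall fun q => ?_)
      simp only [Pi.zero_apply]
      rw [← mul_add, hsum, mul_zero]
    linarith [ibx, iby, h0]
  -- assemble
  rw [e1, e2x, e2y, e3, e4, e5, e6a, e6b]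
  ring

end WeakVorticity

end Summit.AnomalousDissipation.AnomalousDissipation.Theorems.StrainedLayerLaw.StrainWorkSumRule

end
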